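/-
Copyright: cell pub-balaban-gaps (YM BLITZ Y1, track G1), seat g1-p2 GEN 8 (unit `pub-balaban-gaps-g1-p2`).  Row (D4) NODE O,
JUNCTION J-3 (multi-level), TRANSPORTER BACKGROUND: [B9] Cor. 3.5's step for the covariant Laplacian of a bond-transporter background
`U` with the two (3.37)-type letters (bond: row ∕ column sums of `U − 1` at most `ηα₀`; derivative: of `U(b) − U(b − e_μ)` at most
`η²α₁`), plus a cube-local averaging slot, ON THE GENUINE MULTI-LEVEL FLAT PROPAGATOR `η²G′ ⊗ 1` of [4] Prop. 2.2 for a nested family of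
domains of the torus — the instance of the carrier-generic `D4WalkBlockShiftTransport` at `boxDom N₀` with the unit translations (60b's
one-scale END, now for the nested family; constants uniform in `k`, the torus, `{Ω_j}`, explicit in `(α₀, α₁, α_av, d, N)`).  HONEST
FRAMING: the flat operator is the lineage's scalar model; transporters and `V_av` are hypothesis SHAPES (Bałaban's `U′ = e^{iηA}`,
`F′₂` NOT constructed); (D4) NOT discharged (instance 0∕1); NOT BetaPertH, NOT continuum, NOT Clay.
-/
import Summits.QuantumFields.BalabanUV.Gaps.D4WalkBlockCovariantShiftMultiLevel
import Summits.QuantumFields.BalabanUV.Gaps.D4WalkBlockShiftTransport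

/-!
# `Gaps.D4WalkBlockCovariantTransportMultiLevel` — Cor. 3.5's step in a transporter background with (3.37)-type letters on the
# genuine multi-level flat propagator of [4]'s nested family (cell pub-balaban-gaps, seat g1-p2 gen 8)

HONEST DEPENDENCY (cell pub-balaban, verbatim): continuum YM on T⁴ ⇐ BetaPertH ∧ nine spine estimates (0/9 proved);
BetaPertH ⇐ (D1) ∧ (D4) ∧ CAP+tail.

**`blockWalkExpansion_transport_multiLevelTorus`**: ∃ `δ₁, C, M₀ > 0`, `N₀ ≥ 1` (functions of `d, ℓ`, weight windows ONLY) such that for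
every admissible `(k, M_h, R, P, D, a, c, Kc)` of [4] Prop. 2.2 on the torus, every `N`, every holomorphic family of forward bond
transporters `U⁺_μ(u, x) ∈ Matrix (Fin N) (Fin N) ℂ` with inverses on a ball satisfying the BOND letter `ηα₀` and the DERIVATIVE letter
`η²α₁` (`η = L^{−k}`; `x − e_μ` = the inverse unit translation of the fundamental box), every holomorphic cube-local `V_av` with row sums
`≤ α_av`, every cube row sum `(μ, c_μ)`, `2μ ≤ ε`, `2μ ≤ δ₁ − ε − μ`, and the MARGIN with `α = 2α₀ + α₀²`, `α′ = (d+1)(2α₁ + 4α₀²) + α_av`: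
`(W ⊗ 1)(1 − (V_W(u) + V_av(u))(W ⊗ 1))⁻¹` (`W = η²(G′.map ofReal)`, defects `conjOp U⁺U⁻ − 1`, `conjOp U⁻(x−e_μ)U⁺(x−e_μ) − 1`) is a
block walk expansion at `(ε − 2μ, δ₁ − ε − 3μ, ·, δ₁ − 2μ)` with the relative derivative letters `covB δ₁` and dominating distances.
WHAT IT IS NOT.  `U = e^X` from windows on `X` (61a's exp window composes here unchanged — fibre algebra); the genuine averaging `P_K(U)`
and contour transporters (63–66, one-scale carrier today); (D4) instance 0∕1; words of row (D4) UNCHANGED.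

References: T. Bałaban, Comm. Math. Phys. **99** (1985) 389–434 [B9], (3.37) p. 396, (3.50)–(3.54) pp. 400–401, (3.57)–(3.64) pp. 401–402,
Cor. 3.5 p. 407; Comm. Math. Phys. **96** (1984) [4], Prop. 2.2 (2.67) p. 234, p. 224; Comm. Math. Phys. **116** (1988) [II], (1.11) p. 5.
-/

noncomputable section

namespace Summit.QuantumFields.BalabanUV.Gaps.D4WalkBlockCovariantTransportMultiLevel

open Finset Metric NormedSpace
open scoped Matrix
open Literature.MathematicalPhysics.QuantumFieldTheory.Balaban1983to89
open Literature.MathematicalPhysics.QuantumFieldTheory.Balaban1983to89.B4Reflection242 (boxDom)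
open Literature.MathematicalPhysics.QuantumFieldTheory.Balaban1983to89.B9SectDWalk (DomBy)
open Literature.MathematicalPhysics.QuantumFieldTheory.Balaban1983to89.B9Thm34Ext (toB6)
open Literature.MathematicalPhysics.QuantumFieldTheory.Balaban1983to89.B9Thm37GlueTorus (torusGeom tdist1)
open Literature.MathematicalPhysics.QuantumFieldTheory.Balaban1983to89.TreeLengthTorus (TPt)
open Literature.MathematicalPhysics.QuantumFieldTheory.Balaban1983to89.B5TorusCover (UT)
open Literature.MathematicalPhysics.QuantumFieldTheory.Balaban1983to89.B11SectG (RowSum)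
open Literature.MathematicalPhysics.QuantumFieldTheory.Balaban1983to89.B6MultiLevelBoxOperator (N0)
open Literature.MathematicalPhysics.QuantumFieldTheory.Balaban1983to89.B6MultiLevelTorusOperator (TDomains gmlT tshift unitVec)
open Literature.MathematicalPhysics.QuantumFieldTheory.Balaban1983to89.B6Ineq243TwoLevelBox (aNext)
open Summit.QuantumFields.BalabanUV.Gaps.D4WalkBlock (blockNorm BlockWalkExpansion)
open Summit.QuantumFields.BalabanUV.Gaps.D4WalkBlockTransportAlgebra (conjOp rowSumNorm colSumNorm)
open Summit.QuantumFields.BalabanUV.Gaps.D4WalkBlockMultiLevelGeometry (cubeML)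
open Summit.QuantumFields.BalabanUV.Gaps.D4WalkBlockFlatFibreMultiLevel (flatLettersFibre_multiLevelTorus)
open Summit.QuantumFields.BalabanUV.Gaps.D4WalkBlockShiftAlgebra (covDop covB covShift)
open Summit.QuantumFields.BalabanUV.Gaps.D4WalkBlockShiftTransport (blockWalkExpansion_transport_of_letters
  blockWalkExpansion_expTransport_of_letters)
open Summit.QuantumFields.BalabanUV.Gaps.D4WalkBlockCovariantShiftMultiLevel (tdist1_cubeML_tshift_symm_unitVec_le_one Dfw_tshift_eq)

variable {d : ℕ}
variable {dd N' : ℕ} {E : Type*} [NormedAddCommGroup E] [NormedSpace ℂ E]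

/-- **[B9] COR. 3.5's STEP IN A TRANSPORTER BACKGROUND WITH (3.37)-TYPE LETTERS ON THE GENUINE MULTI-LEVEL FLAT PROPAGATOR — UNIFORM IN
`k`, THE TORUS, `{Ω_j}`; EXPLICIT IN `(α₀, α₁, α_av, d, N)`.** [cite: Balaban1985BackgroundPropagators, Cor. 3.5 p.407, (3.37) p.396, (3.50)–(3.54) pp.400–401, (3.57)–(3.64) pp.401–402; Balaban1984PropagatorsII, Prop. 2.2 (2.67) p.234, p.224; Balaban1988RG2Cluster, (1.11) p.5] -/
theorem blockWalkExpansion_transport_multiLevelTorus (d ℓ : ℕ) (hℓ : 1 ≤ ℓ) (aminus aplus a2minus a2plus : ℝ) (ha : 0 < aminus)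
    (ha2 : 0 < a2minus) :
    ∃ δ₁ C M₀ : ℝ, ∃ N₀ : ℕ, 0 < δ₁ ∧ 0 < C ∧ 0 < M₀ ∧ 0 < N₀ ∧
      ∀ (k Mh R : ℕ), 3 ≤ Mh → M₀ ≤ ((ℓ : ℝ) + 1) * Mh → 2 * (ℓ + 1) ≤ R → N₀ + 1 ≤ R * ((ℓ + 1) * Mh) →
      ∀ (P : Fin (d + 1) → ℕ) (hP : ∀ μ, 1 ≤ P μ) (hP4 : ∀ μ, 4 ≤ P μ) (D : TDomains d ℓ Mh k P R) (a c : ℕ → ℝ),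
        (∀ i, 1 ≤ i → aminus ≤ a i ∧ a i ≤ aplus) → (∀ i, 1 ≤ i → a2minus ≤ c i ∧ c i ≤ a2plus) →
        (∀ i, 1 ≤ i → a (i + 1) = aNext ℓ (a i) (c i)) →
      ∀ (Kc : Fin (d + 1) → ℕ) [∀ i, NeZero (Kc i)], (∀ i, N0 ℓ Mh k P i = (ℓ + 1) ^ k * Kc i) →
      ∀ (N : ℕ) (c₀ : B13.Consts) (Xs : Finset (UT Kc)) (Rb : ℝ)
        (Up Upi : Fin (d + 1) → E → ↥(boxDom (N0 ℓ Mh k P)) → Matrix (Fin N) (Fin N) ℂ)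
        (Vav : E → Matrix (↥(boxDom (N0 ℓ Mh k P)) × (Fin N × Fin N)) (↥(boxDom (N0 ℓ Mh k P)) × (Fin N × Fin N)) ℂ)
        (α₀ α₁ αav ε μ cμ : ℝ),
      (∀ ν x a' c', DifferentiableOn ℂ (fun u => Up ν u x a' c') (ball (0 : E) Rb)) →
      (∀ ν x a' c', DifferentiableOn ℂ (fun u => Upi ν u x a' c') (ball (0 : E) Rb)) →
      (∀ p q, DifferentiableOn ℂ (fun u => Vav u p q) (ball (0 : E) Rb)) →
      (∀ ν u x, Up ν u x * Upi ν u x = 1) → 0 ≤ α₀ → 0 ≤ α₁ → 0 ≤ αav →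
      (∀ ν, ∀ u ∈ ball (0 : E) Rb, ∀ x a',
        rowSumNorm (Up ν u x - 1) a' ≤ (((ℓ : ℝ) + 1) ^ k)⁻¹ * α₀ ∧ colSumNorm (Up ν u x - 1) a' ≤ (((ℓ : ℝ) + 1) ^ k)⁻¹ * α₀ ∧
        rowSumNorm (Upi ν u x - 1) a' ≤ (((ℓ : ℝ) + 1) ^ k)⁻¹ * α₀ ∧ colSumNorm (Upi ν u x - 1) a' ≤ (((ℓ : ℝ) + 1) ^ k)⁻¹ * α₀) →
      (∀ ν, ∀ u ∈ ball (0 : E) Rb, ∀ x a',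
        rowSumNorm (Up ν u x - Up ν u ((tshift (N0 ℓ Mh k P) (unitVec ν)).symm x)) a' ≤ ((((ℓ : ℝ) + 1) ^ k)⁻¹) ^ 2 * α₁ ∧
        colSumNorm (Up ν u x - Up ν u ((tshift (N0 ℓ Mh k P) (unitVec ν)).symm x)) a' ≤ ((((ℓ : ℝ) + 1) ^ k)⁻¹) ^ 2 * α₁) →
      (∀ u p q, Vav u p q ≠ 0 → cubeML ℓ k Kc p.1.1 = cubeML ℓ k Kc q.1.1) →
      (∀ u ∈ ball (0 : E) Rb, ∀ p, ∑ q, ‖Vav u p q‖ ≤ αav) →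
      0 ≤ μ → 2 * μ ≤ ε → 2 * μ ≤ δ₁ - ε - μ → 0 ≤ cμ →
      RowSum (toB6 (torusGeom Kc 0 0 0) 0 True) μ cμ →
      cμ * (cμ * 1 * (1 * ((((d : ℝ) + 1) * (2 * α₁ + 4 * α₀ ^ 2) + αav +
        ∑ j : Fin (d + 1) ⊕ Fin (d + 1), (2 * α₀ + α₀ ^ 2) * covB δ₁ j) * C)) * cμ) * cμ < 1 →
      ∃ (W : Type)
        (T : W → (TPt dd N' → ℂ) → E →
          Matrix (↥(boxDom (N0 ℓ Mh k P)) × (Fin N × Fin N)) (↥(boxDom (N0 ℓ Mh k P)) × (Fin N × Fin N)) ℂ)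
        (SX' : Set W) (A' : W → ℝ) (D' : W → UT Kc → UT Kc → ℝ),
        BlockWalkExpansion c₀ (fun q : ↥(boxDom (N0 ℓ Mh k P)) × (Fin N × Fin N) => cubeML ℓ k Kc q.1.1)
          (fun q => cubeML ℓ k Kc q.1.1)
          (fun (_ : TPt dd N' → ℂ) u =>
            Matrix.blockDiagonal (fun _ : Fin N × Fin N =>
                ((((ℓ : ℂ) + 1) ^ (2 * k))⁻¹ : ℂ) • (gmlT (N0 ℓ Mh k P) ℓ k D.lev a).map ((↑) : ℝ → ℂ)) *
              (1 - (covShift ↥(boxDom (N0 ℓ Mh k P)) (Fin N × Fin N) (fun ν => tshift (N0 ℓ Mh k P) (unitVec ν))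
                  ((((ℓ : ℝ) + 1) ^ k)⁻¹) (fun ν u x => conjOp (Up ν u x) (Upi ν u x) - 1)
                  (fun ν u x => conjOp (Upi ν u ((tshift (N0 ℓ Mh k P) (unitVec ν)).symm x))
                    (Up ν u ((tshift (N0 ℓ Mh k P) (unitVec ν)).symm x)) - 1) u + Vav u) *
                Matrix.blockDiagonal (fun _ : Fin N × Fin N =>
                  ((((ℓ : ℂ) + 1) ^ (2 * k))⁻¹ : ℂ) • (gmlT (N0 ℓ Mh k P) ℓ k D.lev a).map ((↑) : ℝ → ℂ)))⁻¹)
          Xs Rb (ε - 2 * μ) (δ₁ - ε - μ - 2 * μ)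
          (cμ * C * (1 * (1 - cμ * (cμ * 1 * (1 * ((((d : ℝ) + 1) * (2 * α₁ + 4 * α₀ ^ 2) + αav +
            ∑ j : Fin (d + 1) ⊕ Fin (d + 1), (2 * α₀ + α₀ ^ 2) * covB δ₁ j) * C)) * cμ) * cμ)⁻¹) * cμ)
          T SX' A' D' (δ₁ - 2 * μ) ∧
        (∀ (j : Fin (d + 1) ⊕ Fin (d + 1)) ω (σ : TPt dd N' → ℂ), (∀ i, ‖σ i‖ ≤ Real.exp c₀.κ₁) → ∀ u ∈ ball (0 : E) Rb,
          ∀ Y Y',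
          blockNorm (fun q : ↥(boxDom (N0 ℓ Mh k P)) × (Fin N × Fin N) => cubeML ℓ k Kc q.1.1) (fun q => cubeML ℓ k Kc q.1.1)
              (covDop ↥(boxDom (N0 ℓ Mh k P)) (Fin N × Fin N) (fun ν => tshift (N0 ℓ Mh k P) (unitVec ν))
                ((((ℓ : ℝ) + 1) ^ k)⁻¹) j * T ω σ u) Y Y' ≤
            covB (ι := Fin (d + 1)) δ₁ j * (A' ω * Real.exp (-((δ₁ - 2 * μ) * D' ω Y Y')))) ∧
        ∀ ω, DomBy (toB6 (torusGeom Kc 0 0 0) 0 True) (D' ω) := by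
  obtain ⟨δ₁, C, M₀, N₀, hδ₁, hC, hM₀, hN₀, hflat⟩ := flatLettersFibre_multiLevelTorus d ℓ hℓ aminus aplus a2minus a2plus ha ha2
  refine ⟨δ₁, C, M₀, N₀, hδ₁, hC, hM₀, hN₀, ?_⟩
  intro k Mh R hMh hM hR hRM P hP hP4 D a c haw hcw hac Kc _ hKc N c₀ Xs Rb Up Upi Vav α₀ α₁ αav ε μ cμ hUp hUpi hVavh hinv hα₀ hα₁
    hαav hbond hder hloc hav hμ hμε hμκ hcμ hrow hq
  have hl := hflat k Mh R hMh hM hR hRM P hP hP4 D a c haw hcw hac Kc hKc (Fin N × Fin N)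
  have hL1 : (1 : ℝ) ≤ ((ℓ : ℝ) + 1) ^ k := one_le_pow₀ (by linarith [(Nat.cast_nonneg ℓ : (0 : ℝ) ≤ ℓ)])
  have hη : (0 : ℝ) < (((ℓ : ℝ) + 1) ^ k)⁻¹ := by positivity
  have hη1 : (((ℓ : ℝ) + 1) ^ k)⁻¹ ≤ 1 := inv_le_one_of_one_le₀ hL1
  have hcard : (Fintype.card (Fin (d + 1)) : ℝ) = (d : ℝ) + 1 := by rw [Fintype.card_fin]; push_cast; ring
  have h := blockWalkExpansion_transport_of_letters (dd := dd) (N' := N') (sh := fun ν => tshift (N0 ℓ Mh k P) (unitVec ν))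
    (fun x : ↥(boxDom (N0 ℓ Mh k P)) => cubeML ℓ k Kc x.1) hη hη1
    (fun ν x => tdist1_cubeML_tshift_symm_unitVec_le_one hKc ν x) _ hC.le hδ₁.le (fun Y Y' => (hl Y Y').1)
    (fun ν Y Y' => by rw [Dfw_tshift_eq]; exact (hl Y Y').2 ν) c₀ Xs Rb Up Upi Vav α₀ α₁ αav ε μ cμ hUp hUpi hVavh hinv hα₀ hα₁
    hαav hbond hder hloc hav hμ hμε hμκ hcμ hrow
  rw [hcard] at h
  exact h hq

/-- **[B9] COR. 3.5's STEP IN AN EXPONENTIATED SMALL BACKGROUND `U = e^{X}` WITH THE (3.37)-SHAPED WINDOWS ON `X`, ON THE GENUINE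
MULTI-LEVEL FLAT PROPAGATOR** (61b's one-scale END for the nested family): windows `ηa₀` (value) and `η²a₁` (difference along the inverse
unit translation), `η = L^{−k}`; letters `α₀ = a₀e^{a₀}`, `α₁ = a₁e^{a₀}`; margin with `α = 2α₀ + α₀²`, `α′ = (d+1)(2α₁ + 4α₀²) + α_av`.
[cite: Balaban1985BackgroundPropagators, (3.37) p.396, (3.50)–(3.54) pp.400–401, Cor. 3.5 p.407; Balaban1984PropagatorsII, Prop. 2.2 (2.67) p.234, p.224] -/
theorem blockWalkExpansion_expTransport_multiLevelTorus (d ℓ : ℕ) (hℓ : 1 ≤ ℓ) (aminus aplus a2minus a2plus : ℝ) (ha : 0 < aminus)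
    (ha2 : 0 < a2minus) :
    ∃ δ₁ C M₀ : ℝ, ∃ N₀ : ℕ, 0 < δ₁ ∧ 0 < C ∧ 0 < M₀ ∧ 0 < N₀ ∧
      ∀ (k Mh R : ℕ), 3 ≤ Mh → M₀ ≤ ((ℓ : ℝ) + 1) * Mh → 2 * (ℓ + 1) ≤ R → N₀ + 1 ≤ R * ((ℓ + 1) * Mh) →
      ∀ (P : Fin (d + 1) → ℕ) (hP : ∀ μ, 1 ≤ P μ) (hP4 : ∀ μ, 4 ≤ P μ) (D : TDomains d ℓ Mh k P R) (a c : ℕ → ℝ),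
        (∀ i, 1 ≤ i → aminus ≤ a i ∧ a i ≤ aplus) → (∀ i, 1 ≤ i → a2minus ≤ c i ∧ c i ≤ a2plus) →
        (∀ i, 1 ≤ i → a (i + 1) = aNext ℓ (a i) (c i)) →
      ∀ (Kc : Fin (d + 1) → ℕ) [∀ i, NeZero (Kc i)], (∀ i, N0 ℓ Mh k P i = (ℓ + 1) ^ k * Kc i) →
      ∀ (N : ℕ) (c₀ : B13.Consts) (Xs : Finset (UT Kc)) (Rb : ℝ)
        (Xf : Fin (d + 1) → E → ↥(boxDom (N0 ℓ Mh k P)) → Matrix (Fin N) (Fin N) ℂ)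
        (Vav : E → Matrix (↥(boxDom (N0 ℓ Mh k P)) × (Fin N × Fin N)) (↥(boxDom (N0 ℓ Mh k P)) × (Fin N × Fin N)) ℂ)
        (a₀ a₁ αav ε μ cμ : ℝ),
      (∀ ν x a' c', DifferentiableOn ℂ (fun u => exp (Xf ν u x) a' c') (ball (0 : E) Rb)) →
      (∀ ν x a' c', DifferentiableOn ℂ (fun u => exp (-Xf ν u x) a' c') (ball (0 : E) Rb)) →
      (∀ p q, DifferentiableOn ℂ (fun u => Vav u p q) (ball (0 : E) Rb)) →
      0 ≤ a₀ → 0 ≤ a₁ → 0 ≤ αav →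
      (∀ ν, ∀ u ∈ ball (0 : E) Rb, ∀ x a',
        rowSumNorm (Xf ν u x) a' ≤ (((ℓ : ℝ) + 1) ^ k)⁻¹ * a₀ ∧ colSumNorm (Xf ν u x) a' ≤ (((ℓ : ℝ) + 1) ^ k)⁻¹ * a₀) →
      (∀ ν, ∀ u ∈ ball (0 : E) Rb, ∀ x a',
        rowSumNorm (Xf ν u x - Xf ν u ((tshift (N0 ℓ Mh k P) (unitVec ν)).symm x)) a' ≤ ((((ℓ : ℝ) + 1) ^ k)⁻¹) ^ 2 * a₁ ∧
        colSumNorm (Xf ν u x - Xf ν u ((tshift (N0 ℓ Mh k P) (unitVec ν)).symm x)) a' ≤ ((((ℓ : ℝ) + 1) ^ k)⁻¹) ^ 2 * a₁) →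
      (∀ u p q, Vav u p q ≠ 0 → cubeML ℓ k Kc p.1.1 = cubeML ℓ k Kc q.1.1) →
      (∀ u ∈ ball (0 : E) Rb, ∀ p, ∑ q, ‖Vav u p q‖ ≤ αav) →
      0 ≤ μ → 2 * μ ≤ ε → 2 * μ ≤ δ₁ - ε - μ → 0 ≤ cμ →
      RowSum (toB6 (torusGeom Kc 0 0 0) 0 True) μ cμ →
      cμ * (cμ * 1 * (1 * ((((d : ℝ) + 1) * (2 * (a₁ * Real.exp a₀) + 4 * (a₀ * Real.exp a₀) ^ 2) + αav +
        ∑ j : Fin (d + 1) ⊕ Fin (d + 1), (2 * (a₀ * Real.exp a₀) + (a₀ * Real.exp a₀) ^ 2) * covB δ₁ j) * C)) * cμ) * cμ < 1 →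
      ∃ (W : Type)
        (T : W → (TPt dd N' → ℂ) → E →
          Matrix (↥(boxDom (N0 ℓ Mh k P)) × (Fin N × Fin N)) (↥(boxDom (N0 ℓ Mh k P)) × (Fin N × Fin N)) ℂ)
        (SX' : Set W) (A' : W → ℝ) (D' : W → UT Kc → UT Kc → ℝ),
        BlockWalkExpansion c₀ (fun q : ↥(boxDom (N0 ℓ Mh k P)) × (Fin N × Fin N) => cubeML ℓ k Kc q.1.1)
          (fun q => cubeML ℓ k Kc q.1.1)
          (fun (_ : TPt dd N' → ℂ) u =>
            Matrix.blockDiagonal (fun _ : Fin N × Fin N =>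
                ((((ℓ : ℂ) + 1) ^ (2 * k))⁻¹ : ℂ) • (gmlT (N0 ℓ Mh k P) ℓ k D.lev a).map ((↑) : ℝ → ℂ)) *
              (1 - (covShift ↥(boxDom (N0 ℓ Mh k P)) (Fin N × Fin N) (fun ν => tshift (N0 ℓ Mh k P) (unitVec ν))
                  ((((ℓ : ℝ) + 1) ^ k)⁻¹) (fun ν u x => conjOp (exp (Xf ν u x)) (exp (-Xf ν u x)) - 1)
                  (fun ν u x => conjOp (exp (-Xf ν u ((tshift (N0 ℓ Mh k P) (unitVec ν)).symm x)))
                    (exp (Xf ν u ((tshift (N0 ℓ Mh k P) (unitVec ν)).symm x))) - 1) u + Vav u) *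
                Matrix.blockDiagonal (fun _ : Fin N × Fin N =>
                  ((((ℓ : ℂ) + 1) ^ (2 * k))⁻¹ : ℂ) • (gmlT (N0 ℓ Mh k P) ℓ k D.lev a).map ((↑) : ℝ → ℂ)))⁻¹)
          Xs Rb (ε - 2 * μ) (δ₁ - ε - μ - 2 * μ)
          (cμ * C * (1 * (1 - cμ * (cμ * 1 * (1 * ((((d : ℝ) + 1) * (2 * (a₁ * Real.exp a₀) + 4 * (a₀ * Real.exp a₀) ^ 2) + αav +
            ∑ j : Fin (d + 1) ⊕ Fin (d + 1), (2 * (a₀ * Real.exp a₀) + (a₀ * Real.exp a₀) ^ 2) * covB δ₁ j) * C)) * cμ) *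
            cμ)⁻¹) * cμ)
          T SX' A' D' (δ₁ - 2 * μ) ∧
        (∀ (j : Fin (d + 1) ⊕ Fin (d + 1)) ω (σ : TPt dd N' → ℂ), (∀ i, ‖σ i‖ ≤ Real.exp c₀.κ₁) → ∀ u ∈ ball (0 : E) Rb,
          ∀ Y Y',
          blockNorm (fun q : ↥(boxDom (N0 ℓ Mh k P)) × (Fin N × Fin N) => cubeML ℓ k Kc q.1.1) (fun q => cubeML ℓ k Kc q.1.1)
              (covDop ↥(boxDom (N0 ℓ Mh k P)) (Fin N × Fin N) (fun ν => tshift (N0 ℓ Mh k P) (unitVec ν))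
                ((((ℓ : ℝ) + 1) ^ k)⁻¹) j * T ω σ u) Y Y' ≤
            covB (ι := Fin (d + 1)) δ₁ j * (A' ω * Real.exp (-((δ₁ - 2 * μ) * D' ω Y Y')))) ∧
        ∀ ω, DomBy (toB6 (torusGeom Kc 0 0 0) 0 True) (D' ω) := by
  obtain ⟨δ₁, C, M₀, N₀, hδ₁, hC, hM₀, hN₀, hflat⟩ := flatLettersFibre_multiLevelTorus d ℓ hℓ aminus aplus a2minus a2plus ha ha2
  refine ⟨δ₁, C, M₀, N₀, hδ₁, hC, hM₀, hN₀, ?_⟩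
  intro k Mh R hMh hM hR hRM P hP hP4 D a c haw hcw hac Kc _ hKc N c₀ Xs Rb Xf Vav a₀ a₁ αav ε μ cμ hUp hUpi hVavh ha₀ ha₁ hαav
    hw0 hw1 hloc hav hμ hμε hμκ hcμ hrow hq
  have hl := hflat k Mh R hMh hM hR hRM P hP hP4 D a c haw hcw hac Kc hKc (Fin N × Fin N)
  have hL1 : (1 : ℝ) ≤ ((ℓ : ℝ) + 1) ^ k := one_le_pow₀ (by linarith [(Nat.cast_nonneg ℓ : (0 : ℝ) ≤ ℓ)])
  have hη : (0 : ℝ) < (((ℓ : ℝ) + 1) ^ k)⁻¹ := by positivity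
  have hη1 : (((ℓ : ℝ) + 1) ^ k)⁻¹ ≤ 1 := inv_le_one_of_one_le₀ hL1
  have hcard : (Fintype.card (Fin (d + 1)) : ℝ) = (d : ℝ) + 1 := by rw [Fintype.card_fin]; push_cast; ring
  have h := blockWalkExpansion_expTransport_of_letters (dd := dd) (N' := N') (sh := fun ν => tshift (N0 ℓ Mh k P) (unitVec ν))
    (fun x : ↥(boxDom (N0 ℓ Mh k P)) => cubeML ℓ k Kc x.1) hη hη1
    (fun ν x => tdist1_cubeML_tshift_symm_unitVec_le_one hKc ν x) _ hC.le hδ₁.le (fun Y Y' => (hl Y Y').1)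
    (fun ν Y Y' => by rw [Dfw_tshift_eq]; exact (hl Y Y').2 ν) c₀ Xs Rb Xf Vav a₀ a₁ αav ε μ cμ hUp hUpi hVavh ha₀ ha₁ hαav
    hw0 hw1 hloc hav hμ hμε hμκ hcμ hrow
  rw [hcard] at h
  exact h hq

end Summit.QuantumFields.BalabanUV.Gaps.D4WalkBlockCovariantTransportMultiLevel

end
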